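import Mathlib.Algebra.Star.Basic
import Mathlib.Algebra.Order.Field.Basic
import Mathlib.Tactic.Ring
import Mathlib.Tactic.LinearCombination
import Mathlib.Tactic.Linarith
import Mathlib.Tactic.Positivity
import HarnessLib

/-!
# Venture HSemireg — LEMMA 30.2 «PURE TENSORS» of a pair block: the binary Gram identity, the AM–GM trace inequality
# `Tr(BΓ)² ≥ 4·det B·det Γ`, the integrality window, and the pure-tensor value formula (ENGINE-W PROBE5 §30;
# the common engine of THEOREMS 30-A ∕ 30-B ∕ 30-C) — kernel algebra

HONEST FRAMING. Lean index of the computation cell `pub-hsemireg`, widening group ENGINE-W (code A, seat `engine-w-1`,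
gen 17). RING ALGEBRA and ordered-field inequalities in at most twelve variables; no abelian variety, sheaf, `Ext` group,
secant structure or semiregularity map is constructed; nothing here says that HC, HC_CM or HC_AV holds. Theorems only
(0 `def`, 0 named fact, 0 `sorry`). Companion of `PairBlockEvenPolarisationObstruction.lean` (THEOREM 30-J ⊇ 30-A) and
`PairBlockRealDescentGram.lean` (LEMMA 32.1); new namespace `PureTensor` (no name shared with those files).

SOURCE (the cell's own result): `widen/ENGINE-W/out/probe5/PROBE5-STIZ-A.md` §30 (v3.6, engine-w-1 g9), PROPOSITION 30.1
(tensor model) and **LEMMA 30.2** as printed: «m < 0, N > 0, d := det H, x = u + μw̃ ∈ 𝓛 with 𝒫[x] = n. If n < 2√(|m|∕d)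
then u ∥ w̃ over K: x = (α + βμ)·v … then 𝒫[x] = H[v]·B_K(α,β), B_K(α,β) := t|α|² + A·Tr(αβ̄) + N|β|² … PROOF:
n = Tr(BΓ) ≥ 2√(det B·det Γ) = 2√(|m| det Γ) (AM–GM on the eigenvalues of B^{1∕2}ΓB^{1∕2}); det Γ = H[u]H[w̃] − |s|² ∈
(1∕d)ℤ_{≥0}, so det Γ ≠ 0 forces n ≥ 2√(|m|∕d). Hence det Γ = 0, u ∥ w̃ (H definite) … the formulas expand
t(α+βμ)(ᾱ+β̄μ̄)·H[v] with tμμ̄ = N, t(μ+μ̄) = 2A», where `B = [[t, A],[A, N]]` (`det B = tN − A² = −m = |m|`),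
`Γ = [[H[u], s],[s̄, H[w̃]]]`, `s = H(u, w̃) = a + bω ∈ O_K = ℤ[ω]` so that `Tr(BΓ) = t·H[u] + A·Tr(s) + N·H[w̃]`,
`Tr(s) = 2a − b`, `|s|² = a² − ab + b²`; THEOREM 30-A uses it at `n = 1`, `d = 3` («`1 < 2√(|m|∕3)` always»), THEOREM 30-C
at `n = 1` in the window `4|m| > det H`, and §30 (6) lists the five reached NON-product cells `det H₂ = 5, 9, 11, 17, 19` at
`|m| = 1, 2, 2, 1, 2` («all with `4|m| < det H₂`, as THEOREM 30-C requires»). What the kernel holds: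

* §1 **`gram_det_two`** — for a binary form `H = [[a, b],[b̄, c]]` and vectors `u, w` (bars = `star`, any commutative
  star-ring): `H[u]·H[w] − H(u,w)·H(w,u) = (ac − b b̄)·(u₁w₂ − u₂w₁)·(u₁w₂ − u₂w₁)‾` (so `det Γ = det H·|det(u,w)|²`, whence
  «`det Γ ∈ (1∕d)ℤ_{≥0}`» for `w = w̃ ∈ H⁻¹O_K²`), and **`parallel_of_gram_det_zero`** — in a domain where `z z̄ = 0 ⇒ z = 0`
  and `det H ≠ 0`: `det Γ = 0 ⟹ u₁w₂ = u₂w₁` («Hence det Γ = 0, u ∥ w̃»).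
* §2 **`amgm_identity`** (any commutative ring): `t²·(n² − 4D(pq − σ)) = (t²p + tAT + (2A² − tN)q)² + D·((tT + 2Aq)² + t²(4σ − T²))`
  with `n = tp + AT + Nq`, `D = tN − A²`; **`amgm_trace_ineq`** (ordered field): `t ≠ 0`, `D ≥ 0`, `T² ≤ 4σ` ⟹
  `4·D·(pq − σ) ≤ n²` — «`Tr(BΓ) ≥ 2√(det B·det Γ)`» squared, for `Γ = [[p, s],[s̄, q]]`, `Tr s = T`, `|s|² = σ`;
  `eisenstein_trace_sq` — `4(a² − ab + b²) − (2a − b)² = 3b²`, so `T² ≤ 4σ` holds for every `s ∈ ℤ[ω]`.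
* §3 **`window_forces_det_zero`** — the integrality step: `g := d·det Γ ∈ ℤ_{≥0}`, `d·n² ≥ 4·D·g` (§2) and the window
  `d·n² < 4·D` ⟹ `g = 0`; `window_H212` (`3·1² < 4|m|` for every `m ≤ −1`: THEOREM 30-A's «always») and `window_cells`
  (the five reached non-product cells of §30 (6) satisfy `4|m| < det H₂`).
* §4 **`pure_value`** — «`𝒫[x] = H[v]·B_K(α,β)`»'s scalar part: `tμ = A + √m`, `tμ̄ = A − √m`, `tN = A² − m` ⟹
  `t²·(α + βμ)(ᾱ + β̄μ̄) = t·(t·αᾱ + A·(αβ̄ + ᾱβ) + N·ββ̄) + t·√m·(ᾱβ − αβ̄)` (rational part `t·B_K`, `δ`-part as printed).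
WHAT IS NOT HERE: the lattice `𝓛` itself, positivity of `H` and of `𝒫`, the content ideal `c(v)`, THEOREMS 30-A∕B∕C as
lattice statements (30-A's arithmetic skeleton is `PairBlock.pairBlock_H212_never` in the companion file).
-/

namespace Summit.Ventures.HSemireg.PureTensor

/-! ## §1 The binary Gram identity and the purity step -/

/-- **Gram identity** (Lagrange ∕ Cauchy–Binet for a binary sesquilinear form): with
`H(u,w) = a·u₁w̄₁ + b·u₁w̄₂ + b̄·u₂w̄₁ + c·u₂w̄₂`,
`H(u,u)·H(w,w) − H(u,w)·H(w,u) = (ac − b b̄)·(u₁w₂ − u₂w₁)·(u₁w₂ − u₂w₁)‾`. [kernel, `ring`] -/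
theorem gram_det_two {R : Type*} [CommRing R] [StarRing R] (a b c u₁ u₂ w₁ w₂ : R) :
    (a * u₁ * star u₁ + b * u₁ * star u₂ + star b * u₂ * star u₁ + c * u₂ * star u₂)
        * (a * w₁ * star w₁ + b * w₁ * star w₂ + star b * w₂ * star w₁ + c * w₂ * star w₂)
      - (a * u₁ * star w₁ + b * u₁ * star w₂ + star b * u₂ * star w₁ + c * u₂ * star w₂)
        * (a * w₁ * star u₁ + b * w₁ * star u₂ + star b * w₂ * star u₁ + c * w₂ * star u₂)
      = (a * c - b * star b) * ((u₁ * w₂ - u₂ * w₁) * star (u₁ * w₂ - u₂ * w₁)) := by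
  simp only [star_sub, star_mul']
  ring

/-- **«Hence det Γ = 0, u ∥ w̃»**: in a domain in which `z·z̄ = 0 ⇒ z = 0` (e.g. a CM field, `z̄` = complex conjugation)
and with `det H = ac − b b̄ ≠ 0`, the vanishing of the Gram determinant forces `u₁w₂ = u₂w₁` (the two vectors are
proportional). [kernel] -/
theorem parallel_of_gram_det_zero {R : Type*} [CommRing R] [StarRing R] [NoZeroDivisors R]
    (hanis : ∀ z : R, z * star z = 0 → z = 0) (a b c u₁ u₂ w₁ w₂ : R) (hdet : a * c - b * star b ≠ 0)
    (hgram : (a * u₁ * star u₁ + b * u₁ * star u₂ + star b * u₂ * star u₁ + c * u₂ * star u₂)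
        * (a * w₁ * star w₁ + b * w₁ * star w₂ + star b * w₂ * star w₁ + c * w₂ * star w₂)
      - (a * u₁ * star w₁ + b * u₁ * star w₂ + star b * u₂ * star w₁ + c * u₂ * star w₂)
        * (a * w₁ * star u₁ + b * w₁ * star u₂ + star b * w₂ * star u₁ + c * w₂ * star u₂) = 0) :
    u₁ * w₂ = u₂ * w₁ := by
  rw [gram_det_two] at hgram
  rcases mul_eq_zero.1 hgram with h | h
  · exact absurd h hdet
  · exact sub_eq_zero.1 (hanis _ h)

/-! ## §2 The AM–GM trace inequality `Tr(BΓ)² ≥ 4·det B·det Γ` -/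

/-- **AM–GM identity**: with `n = tp + AT + Nq` (`= Tr(BΓ)`, `B = [[t,A],[A,N]]`, `Γ = [[p,s],[s̄,q]]`, `T = s + s̄`,
`σ = s s̄`) and `D = tN − A²` (`= det B`):
`t²·(n² − 4D(pq − σ)) = (t²p + tAT + (2A² − tN)q)² + D·((tT + 2Aq)² + t²(4σ − T²))` — the sum-of-squares behind
«`Tr(BΓ) ≥ 2√(det B·det Γ)` (AM–GM on the eigenvalues of `B^{1∕2}ΓB^{1∕2}`)». [kernel, `ring`] -/
theorem amgm_identity {R : Type*} [CommRing R] (t A N p q T σ : R) :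
    t ^ 2 * ((t * p + A * T + N * q) ^ 2 - 4 * (t * N - A ^ 2) * (p * q - σ))
      = (t ^ 2 * p + t * A * T + (2 * A ^ 2 - t * N) * q) ^ 2
        + (t * N - A ^ 2) * ((t * T + 2 * A * q) ^ 2 + t ^ 2 * (4 * σ - T ^ 2)) := by
  ring

/-- **AM–GM trace inequality**: over an ordered field, `t ≠ 0`, `det B = tN − A² ≥ 0` and `T² ≤ 4σ` (true for the trace
and norm of any `s ∈ ℤ[ω]`, `eisenstein_trace_sq`) give `4·(tN − A²)·(pq − σ) ≤ (tp + AT + Nq)²`, i.e.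
`Tr(BΓ)² ≥ 4·det B·det Γ`. [kernel] -/
theorem amgm_trace_ineq {F : Type*} [Field F] [LinearOrder F] [IsStrictOrderedRing F] (t A N p q T σ : F)
    (ht : t ≠ 0) (hD : 0 ≤ t * N - A ^ 2) (hσ : T ^ 2 ≤ 4 * σ) :
    4 * (t * N - A ^ 2) * (p * q - σ) ≤ (t * p + A * T + N * q) ^ 2 := by
  have ht2 : 0 < t ^ 2 := by positivity
  have hS : 0 ≤ (t ^ 2 * p + t * A * T + (2 * A ^ 2 - t * N) * q) ^ 2
      + (t * N - A ^ 2) * ((t * T + 2 * A * q) ^ 2 + t ^ 2 * (4 * σ - T ^ 2)) := by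
    have h1 : 0 ≤ (t * T + 2 * A * q) ^ 2 + t ^ 2 * (4 * σ - T ^ 2) :=
      add_nonneg (sq_nonneg _) (mul_nonneg ht2.le (by linarith))
    exact add_nonneg (sq_nonneg _) (mul_nonneg hD h1)
  rw [← amgm_identity] at hS
  nlinarith [hS, ht2]

/-- The Eisenstein input of `amgm_trace_ineq`: for `s = a + bω ∈ ℤ[ω]` (`ω² + ω + 1 = 0`), `Tr s = 2a − b` and
`|s|² = a² − ab + b²`, and `4|s|² − (Tr s)² = 3b²` (`≥ 0`). [kernel, `ring`] -/
theorem eisenstein_trace_sq (a b : ℤ) : 4 * (a ^ 2 - a * b + b ^ 2) - (2 * a - b) ^ 2 = 3 * b ^ 2 := by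
  ring

/-- Hence `(Tr s)² ≤ 4|s|²` for every `s ∈ ℤ[ω]`. [kernel] -/
theorem eisenstein_trace_sq_le (a b : ℤ) : (2 * a - b) ^ 2 ≤ 4 * (a ^ 2 - a * b + b ^ 2) := by
  nlinarith [eisenstein_trace_sq a b, sq_nonneg b]

/-! ## §3 The integrality window -/

/-- **«det Γ ≠ 0 forces n ≥ 2√(|m|∕d). Hence det Γ = 0»**: write `g = d·det Γ ∈ ℤ_{≥0}` (`det Γ ∈ (1∕d)ℤ_{≥0}`); the
AM–GM inequality reads `d·n² ≥ 4·D·g` (`D = |m| ≥ 0`) and the window `d·n² < 4·D` (i.e. `n < 2√(D∕d)`) leaves only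
`g = 0`. [kernel] -/
theorem window_forces_det_zero (d n D g : ℤ) (hg : 0 ≤ g) (hD : 0 ≤ D) (hamgm : 4 * D * g ≤ d * n ^ 2)
    (hwin : d * n ^ 2 < 4 * D) : g = 0 := by
  by_contra hne
  have hg1 : 1 ≤ g := by omega
  nlinarith

/-- THEOREM 30-A's window «`1 < 2√(|m|∕3)` always»: `3·1² < 4|m|` for every `m ≤ −1` (`H = [[2,1],[1,2]]`, `d = 3`,
`n = 𝒫[c₁] = 1`). [kernel] -/
theorem window_H212 (m : ℤ) (hm : m ≤ -1) : 3 * (1 : ℤ) ^ 2 < 4 * (-m) := by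
  omega

/-- §30 (6): the five reached NON-product cells `(|m|, det H₂) = (1, 5), (2, 9), (2, 11), (1, 17), (2, 19)` all lie in the
window `4|m| < det H₂` («as THEOREM 30-C requires»), while `[[2,1],[1,2]]` (`det 3`) lies outside it at every `m`
(`window_H212`). [kernel, `decide`] -/
theorem window_cells :
    4 * 1 < (5 : ℤ) ∧ 4 * 2 < (9 : ℤ) ∧ 4 * 2 < (11 : ℤ) ∧ 4 * 1 < (17 : ℤ) ∧ 4 * 2 < (19 : ℤ) := by
  decide

/-! ## §4 The pure-tensor value formula -/

/-- **«the formulas expand `t(α+βμ)(ᾱ+β̄μ̄)·H[v]` with `tμμ̄ = N`, `t(μ+μ̄) = 2A`»**: with `tμ = A + r`, `tμ̄ = A − r`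
(`r = √m`, `r² = m`) and `tN = A² − m`, the scalar factor satisfies
`t²·(α + βμ)(ᾱ + β̄μ̄) = t·(t·αᾱ + A·(αβ̄ + ᾱβ) + N·ββ̄) + t·r·(ᾱβ − αβ̄)` — `t·B_K(α, β)` plus `t` times the `δ`-part
«`(ᾱβ − αβ̄)√m`» (any commutative star-ring). [kernel] -/
theorem pure_value {R : Type*} [CommRing R] [StarRing R] (t A N m r μ α β : R)
    (hμ : t * μ = A + r) (hμ' : t * star μ = A - r) (hr : r ^ 2 = m) (ht : t * N = A ^ 2 - m) :
    t ^ 2 * ((α + β * μ) * star (α + β * μ))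
      = t * (t * (α * star α) + A * (α * star β + star α * β) + N * (β * star β))
        + t * r * (star α * β - α * star β) := by
  simp only [star_add, star_mul']
  linear_combination (t * α * star β + β * star β * (t * μ)) * hμ'
    + (t * star α * β + β * star β * (A - r)) * hμ - β * star β * hr - β * star β * ht

end Summit.Ventures.HSemireg.PureTensor
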